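/-
Copyright (c) 2026 the pub-hodgecm-mathlib formalisation cell (harness21).  Prover seat hodgecm-mathlib-K2Liu-p06 (g3): Track B «K2-LIT»,
hLiu418 = stmt-HodgeConjecture-24832, director req649 (S1) ∕ LEAD F0P6-plan (g12) word 2026-09-04T06:45:31Z «(i) Levi bookkeeping leaf NOW»; organ Φ2 file 6.
-/
import Summits.HodgeConjecture.HodgeConjecture.Theorems.K2LiuSiegelMiddleStabilizerNontrivial   -- ★ Φ2 files 1–5 (+ Φ1)
import HarnessLib

/-!
# Crux `HLiu418`, ROAD Φ, organ Φ2 (file 6): LEVI BOOKKEEPING — `P_Δ` normalises `N_Δ`, `X(p⁻¹ u p) = a⁻¹ X(u) d`, and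
# `ψ_S(p⁻¹ u p) = ψ_{S^p}(u)` with `S^p = D₀ S A₀⁻¹` again `T_L`-skew and `det S^p ≠ 0 ⟺ det S ≠ 0`

Cell `hodgecm-mathlib`, crux item hLiu418 = `stmt-HodgeConjecture-24832`, route `HCCMUnconditional`; squad K2 ∕ K2Liu, LEAD F0P6-plan (g12), deal req649 (S1),
prover K2Liu-p06 (g3).  THEOREMS ONLY (no `def`, no instance, no notation, no named-fact hypothesis, no `sorry`); lane
`--supports stmt-HodgeConjecture-24832 --as helper` (count-neutral).

WHY.  The middle `N_Δ(L⁺)`-orbits of `P_Δ(L⁺)\H(L⁺)` are represented by `γ₀ = w_g p` (`p ∈ P_Δ(L⁺)`); their adelic stabilisers are `p⁻¹ N_g(𝔸) p`.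
★ file 5 produces `u ∈ N_g(𝔸)` with `ψ_{S'}(u) ≠ 1` for any non-degenerate index `S'`; to feed ★ file 3 at `γ₀ = w_g p` one conjugates: `s₀ = p⁻¹ u p` and
`ψ_S(s₀) = ψ_{S^p}(u)`.  In the triangular frame `E₁ · blk · E₂` (★ `conjE_eq`): a Siegel element has frame `(a b; 0 d)` (`a = deltaBlock p`), a unipotent one
`(1 X; 0 1)`, and frames multiply (★ `conj_blk_mul`), so `p · (p⁻¹ u p) = u · p` reads `(a b; 0 d)(1 X'; 0 1) = (1 X; 0 1)(a b; 0 d)`, i.e. `a X' = X d`.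
* §1 abstract block algebra: frames of products of block-upper matrices (`toBlocks₂₂_mul_of_toBlocks₂₁_eq_zero`), the corner identity
  `corner_conj_eq` (`a X' = X d`), and the SKEWNESS TRANSPORT `skew_conj_of_rel`: if `σ(a)ᵀ T d = T` (the Levi unitarity relation) and `T S + σ(S)ᵀ T = 0`
  then `T (d S a⁻¹) + σ(d S a⁻¹)ᵀ T = 0`.
* §2 `conj_mem_unipDelta` (**`P_Δ(𝔸)` normalises `N_Δ(𝔸)`**), **`deltaBlock_mul_toBlocks₁₂_conj`** (`a · X(p⁻¹ u p) = X(u) · d`), the unitarity relation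
  `levi_rel` (`σ(a)ᵀ T d = T`, from ★ `frame_blk_unitary`).
* §3 rational `p`: **`exists_rat_levi_blocks`** — `A₀, D₀ ∈ GL_n(L)` with `a = A₀ ⊗ 1`, `d = D₀ ⊗ 1`, `σ(A₀)ᵀ T_L D₀ = T_L`; **`unipDeltaChar_conj_eq`**:
  `ψ_S(p⁻¹ u p) = ψ_{D₀ S A₀⁻¹}(u)`; `conj_index_mem_skewMatrices`; `det_conj_index_ne_zero_iff`.
[MoeglinWaldspurger1995, II.1.7], [KudlaRallis1994, §2], [HarrisKudlaSweet1996, §1 (1.11)–(1.12)], [GelbartPiatetskishapiroRallis1987, Part A §1].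

HONEST LABEL.  Count-neutral helper; `HC_CM` is proved only modulo the 7 printed citations (2 remaining named inputs: hLiu418 = `stmt-HodgeConjecture-24832`,
h413 = `stmt-HodgeConjecture-24833`) until rung 0 closes.
-/

set_option autoImplicit false
set_option linter.dupNamespace false -- the mandated namespace repeats `HodgeConjecture.HodgeConjecture`

noncomputable section

open scoped Matrix
open NumberField IsDedekindDomain
open Literature.NumberTheory.Automorphic Literature.NumberTheory.Automorphic.UnitaryGroup Literature.NumberTheory.GaloisRepresentations
open Literature.NumberTheory.GelbartRogawski1991 Literature.NumberTheory.GelbartRogawski1991.GRConstruction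
open Literature.NumberTheory.K2Lit.SiegelDoubled

namespace Summit.HodgeConjecture.HodgeConjecture.Cruxes.HLiu418.K2LiuSiegelLeviConjUnipDeltaChar

open K2LiuSiegelUnipotentFourierDefs K2LiuSiegelUnipotentCharacters K2LiuSiegelBruhatCellsDelta K2LiuSiegelDoubledLeviMatrix K2LiuSiegelDoubledRationalPoints
open Literature.NumberTheory.Automorphic.DoubledUnitary.RankOneReduction (mem_range_toAdelic_iff)

/-! ## §1 Abstract block algebra -/

section Blocks

variable {R : Type*} [CommRing R] {ι : Type*} [Fintype ι] [DecidableEq ι]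

omit [Fintype ι] [DecidableEq ι] in
/-- a block-upper matrix is the `fromBlocks` of its blocks. [folklore] -/
theorem eq_fromBlocks_of_toBlocks₂₁_eq_zero {M : Matrix (ι ⊕ ι) (ι ⊕ ι) R} (hM : M.toBlocks₂₁ = 0) :
    M = Matrix.fromBlocks M.toBlocks₁₁ M.toBlocks₁₂ 0 M.toBlocks₂₂ := by
  rw [← hM]; exact (Matrix.fromBlocks_toBlocks M).symm

/-- **the corner identity**: if `F_p · F' = F_u · F_p` with `F_p = (a b; 0 d)` block-upper, `F' = (1 X'; 0 1)`, `F_u = (1 X; 0 1)`, then `a X' = X d`.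
[cite: HarrisKudlaSweet1996, §1 (1.12)] -/
theorem corner_conj_eq {Fp : Matrix (ι ⊕ ι) (ι ⊕ ι) R} (hFp : Fp.toBlocks₂₁ = 0) (X X' : Matrix ι ι R)
    (h : Fp * Matrix.fromBlocks 1 X' 0 1 = Matrix.fromBlocks 1 X 0 1 * Fp) : Fp.toBlocks₁₁ * X' = X * Fp.toBlocks₂₂ := by
  rw [eq_fromBlocks_of_toBlocks₂₁_eq_zero hFp, Matrix.fromBlocks_multiply, Matrix.fromBlocks_multiply] at h
  have h12 := congrArg Matrix.toBlocks₁₂ h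
  simp only [Matrix.toBlocks_fromBlocks₁₂, Matrix.mul_one, Matrix.one_mul, Matrix.mul_zero, add_zero] at h12
  -- `h12 : a X' + b = b + X d`
  have := congrArg (fun Z => Z - Fp.toBlocks₁₂) h12
  simpa [add_sub_cancel_right, add_sub_cancel_left] using this

/-- **skewness transport along the Levi relation**: `σ(a)ᵀ T d = T`, `T S + σ(S)ᵀ T = 0`, `T` symmetric `σ`-fixed, `σ` an involution, `a` invertible
⟹ `T (d S a⁻¹) + σ(d S a⁻¹)ᵀ T = 0`. [cite: HarrisKudlaSweet1996, §1 (1.11)] -/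
theorem skew_conj_of_rel (σ : R →+* R) {T : Matrix ι ι R} (hTσ : T.map σ = T) (hTt : Tᵀ = T) (hσ : ∀ x, σ (σ x) = x)
    {a d S : Matrix ι ι R} (ha : IsUnit a.det) (hrel : (a.map σ)ᵀ * T * d = T) (hS : T * S + (S.map σ)ᵀ * T = 0) :
    T * (d * S * a⁻¹) + ((d * S * a⁻¹).map σ)ᵀ * T = 0 := by
  have hstar_mul : ∀ X Y : Matrix ι ι R, ((X * Y).map σ)ᵀ = (Y.map σ)ᵀ * (X.map σ)ᵀ := fun X Y => by
    rw [Matrix.map_mul, Matrix.transpose_mul]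
  have hstar_star : ∀ X : Matrix ι ι R, ((X.map σ)ᵀ.map σ)ᵀ = X := fun X => by
    rw [Matrix.transpose_map, Matrix.map_map, show (σ ∘ σ : R → R) = id from funext hσ, Matrix.map_id, Matrix.transpose_transpose]
  have haσ : IsUnit ((a.map σ)ᵀ).det := by
    rw [Matrix.det_transpose, ← RingHom.mapMatrix_apply, ← RingHom.map_det]; exact ha.map _
  -- the `σ`-transpose of the Levi relation: `d* T a = T`
  have h1 : (d.map σ)ᵀ * T * a = T := by
    have h := congrArg (fun Z : Matrix ι ι R => (Z.map σ)ᵀ) hrel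
    simp only [hstar_mul, hstar_star] at h
    rw [← Matrix.transpose_map, hTσ, hTt, ← Matrix.mul_assoc] at h
    exact h
  -- conjugate the target by the invertible `a*` … `a`
  have key : (a.map σ)ᵀ * (T * (d * S * a⁻¹) + ((d * S * a⁻¹).map σ)ᵀ * T) * a = 0 := by
    have t1 : (a.map σ)ᵀ * (T * (d * S * a⁻¹)) * a = T * S := by
      rw [show (a.map σ)ᵀ * (T * (d * S * a⁻¹)) * a = ((a.map σ)ᵀ * T * d) * S * (a⁻¹ * a) by simp only [Matrix.mul_assoc], hrel,
        Matrix.nonsing_inv_mul a ha, Matrix.mul_one]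
    have t2 : (a.map σ)ᵀ * (((d * S * a⁻¹).map σ)ᵀ * T) * a = (S.map σ)ᵀ * T := by
      rw [hstar_mul, hstar_mul, show (a.map σ)ᵀ * ((a⁻¹.map σ)ᵀ * ((S.map σ)ᵀ * (d.map σ)ᵀ) * T) * a =
        ((a.map σ)ᵀ * (a⁻¹.map σ)ᵀ) * (S.map σ)ᵀ * ((d.map σ)ᵀ * T * a) by simp only [Matrix.mul_assoc], h1, ← hstar_mul,
        Matrix.nonsing_inv_mul a ha, Matrix.map_one σ (map_zero σ) (map_one σ), Matrix.transpose_one, Matrix.one_mul]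
    rw [Matrix.mul_add, Matrix.add_mul, t1, t2, hS]
  have hM : T * (d * S * a⁻¹) + ((d * S * a⁻¹).map σ)ᵀ * T =
      ((a.map σ)ᵀ)⁻¹ * ((a.map σ)ᵀ * (T * (d * S * a⁻¹) + ((d * S * a⁻¹).map σ)ᵀ * T) * a) * a⁻¹ := by
    rw [Matrix.mul_assoc ((a.map σ)ᵀ), Matrix.nonsing_inv_mul_cancel_left _ _ haσ, Matrix.mul_nonsing_inv_cancel_right a _ ha]
  rw [hM, key, Matrix.mul_zero, Matrix.zero_mul]

end Blocks

/-! ## §2 `P_Δ(𝔸)` normalises `N_Δ(𝔸)`; the corner of the conjugate; the Levi relation -/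

variable (L : Type) [Field L] [NumberField L] [IsCMField L]
variable {N M n : ℕ} (e : Fin N × Fin M ≃ Fin n)
  (dV : Fin N → L) (hdV : ∀ i, IsCMField.complexConj L (dV i) = dV i)
  (dW : Fin M → L) (hdW : ∀ i, IsCMField.complexConj L (dW i) = dW i)

/-- the `(2,2)`-frame blocks of Siegel elements multiply. [cite: HarrisKudlaSweet1996, §1 (1.11)] -/
theorem frame₂₂_mul {p q : HA L e dV hdV dW hdW} (hp : IsSiegelDelta L e dV hdV dW hdW p) (hq : IsSiegelDelta L e dV hdV dW hdW q) :
    (Matrix.fromBlocks (1 : Matrix (Fin n) (Fin n) (AdeleRing (𝓞 L) L)) 0 (-1) 1 * blk L e dV hdV dW hdW (p * q) * Matrix.fromBlocks 1 0 1 1).toBlocks₂₂ =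
      (Matrix.fromBlocks (1 : Matrix (Fin n) (Fin n) (AdeleRing (𝓞 L) L)) 0 (-1) 1 * blk L e dV hdV dW hdW p * Matrix.fromBlocks 1 0 1 1).toBlocks₂₂ *
        (Matrix.fromBlocks (1 : Matrix (Fin n) (Fin n) (AdeleRing (𝓞 L) L)) 0 (-1) 1 * blk L e dV hdV dW hdW q * Matrix.fromBlocks 1 0 1 1).toBlocks₂₂ := by
  have hp' := (isSiegelDelta_iff_conj L e dV hdV dW hdW p).1 hp
  have hq' := (isSiegelDelta_iff_conj L e dV hdV dW hdW q).1 hq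
  rw [conj_blk_mul, eq_fromBlocks_of_toBlocks₂₁_eq_zero hp', eq_fromBlocks_of_toBlocks₂₁_eq_zero hq', Matrix.fromBlocks_multiply]
  simp only [Matrix.toBlocks_fromBlocks₂₂, Matrix.zero_mul, zero_add]

/-- **`P_Δ(𝔸)` normalises `N_Δ(𝔸)`: `p⁻¹ u p ∈ N_Δ(𝔸)`** (★ `mem_unipDelta_iff_blocks`: Siegel, `Δ`-block `a⁻¹ · 1 · a = 1`, frame `(2,2)`-block `d⁻¹ · 1 · d = 1`).
[cite: MoeglinWaldspurger1995, I.2.1] [cite: HarrisKudlaSweet1996, §1 (1.12)] -/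
theorem conj_mem_unipDelta {p : HA L e dV hdV dW hdW} (hp : IsSiegelDelta L e dV hdV dW hdW p) {u : HA L e dV hdV dW hdW}
    (hu : u ∈ unipDelta L e dV hdV dW hdW) : p⁻¹ * u * p ∈ unipDelta L e dV hdV dW hdW := by
  obtain ⟨huS, huΔ, hu22⟩ := (mem_unipDelta_iff_blocks L e dV hdV dW hdW u).1 hu
  have hpinv := isSiegelDelta_inv L e dV hdV dW hdW hp
  refine (mem_unipDelta_iff_blocks L e dV hdV dW hdW _).2 ⟨isSiegelDelta_mul L e dV hdV dW hdW (isSiegelDelta_mul L e dV hdV dW hdW hpinv huS) hp, ?_, ?_⟩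
  · -- `Δ`-blocks: `a(p⁻¹) a(u) a(p) = a(p⁻¹) a(p) = 1`
    rw [deltaBlock_mul L e dV hdV dW hdW (isSiegelDelta_mul L e dV hdV dW hdW hpinv huS) hp, deltaBlock_mul L e dV hdV dW hdW hpinv huS, huΔ, mul_one,
      ← deltaBlock_mul L e dV hdV dW hdW hpinv hp, inv_mul_cancel, deltaBlock_eq_conj, conj_blk_one, ← Matrix.fromBlocks_one,
      Matrix.toBlocks_fromBlocks₁₁]
  · -- `(2,2)`-frame blocks: via `conjE_eq` the condition is `frame₂₂ = 1`
    have h22 : ∀ x : HA L e dV hdV dW hdW, (blk L e dV hdV dW hdW x).toBlocks₂₂ - (blk L e dV hdV dW hdW x).toBlocks₁₂ =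
        (Matrix.fromBlocks (1 : Matrix (Fin n) (Fin n) (AdeleRing (𝓞 L) L)) 0 (-1) 1 * blk L e dV hdV dW hdW x * Matrix.fromBlocks 1 0 1 1).toBlocks₂₂ := fun x => by
      rw [conjE_eq, Matrix.toBlocks_fromBlocks₂₂]
    rw [h22] at hu22 ⊢
    rw [frame₂₂_mul L e dV hdV dW hdW (isSiegelDelta_mul L e dV hdV dW hdW hpinv huS) hp, frame₂₂_mul L e dV hdV dW hdW hpinv huS, hu22, mul_one,
      ← frame₂₂_mul L e dV hdV dW hdW hpinv hp, inv_mul_cancel, conj_blk_one, ← Matrix.fromBlocks_one, Matrix.toBlocks_fromBlocks₂₂]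

/-- **The corner of the conjugate**: `deltaBlock p · X(p⁻¹ u p) = X(u) · d(p)` (`d(p)` = the `(2,2)`-block of the frame of `p`), i.e. `X(p⁻¹ u p) = a⁻¹ X(u) d`.
[cite: HarrisKudlaSweet1996, §1 (1.12)] -/
theorem deltaBlock_mul_toBlocks₁₂_conj {p : HA L e dV hdV dW hdW} (hp : IsSiegelDelta L e dV hdV dW hdW p) {u : HA L e dV hdV dW hdW}
    (hu : u ∈ unipDelta L e dV hdV dW hdW) :
    deltaBlock L e dV hdV dW hdW p * (blk L e dV hdV dW hdW (p⁻¹ * u * p)).toBlocks₁₂ =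
      (blk L e dV hdV dW hdW u).toBlocks₁₂ *
        (Matrix.fromBlocks (1 : Matrix (Fin n) (Fin n) (AdeleRing (𝓞 L) L)) 0 (-1) 1 * blk L e dV hdV dW hdW p * Matrix.fromBlocks 1 0 1 1).toBlocks₂₂ := by
  have hp' := (isSiegelDelta_iff_conj L e dV hdV dW hdW p).1 hp
  have hmul : p * (p⁻¹ * u * p) = u * p := by group
  have h := conj_blk_mul L e dV hdV dW hdW p (p⁻¹ * u * p)
  rw [hmul, conj_blk_mul, (mem_unipDelta_iff_conj L e dV hdV dW hdW u).1 hu,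
    (mem_unipDelta_iff_conj L e dV hdV dW hdW _).1 (conj_mem_unipDelta L e dV hdV dW hdW hp hu)] at h
  rw [deltaBlock_eq_conj]
  exact corner_conj_eq hp' _ _ h.symm

/-- **The Levi unitarity relation `σ(a)ᵀ T_𝔸 d = T_𝔸`** for a Siegel element with frame `(a b; 0 d)` (the `(1,2)`-block of ★ `frame_blk_unitary` at `C = 0`).
[cite: HarrisKudlaSweet1996, §1 (1.11)] -/
theorem levi_rel {p : HA L e dV hdV dW hdW} (hp : IsSiegelDelta L e dV hdV dW hdW p) :
    ((deltaBlock L e dV hdV dW hdW p).map (conjAdele (Fp L) L (IsCMField.complexConj L)))ᵀ *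
        (gramR L e dV hdV dW hdW).map ((algebraMap L (AdeleRing (𝓞 L) L)).comp (algebraMap (Fp L) L)) *
        (Matrix.fromBlocks (1 : Matrix (Fin n) (Fin n) (AdeleRing (𝓞 L) L)) 0 (-1) 1 * blk L e dV hdV dW hdW p * Matrix.fromBlocks 1 0 1 1).toBlocks₂₂ =
      (gramR L e dV hdV dW hdW).map ((algebraMap L (AdeleRing (𝓞 L) L)).comp (algebraMap (Fp L) L)) := by
  set T := (gramR L e dV hdV dW hdW).map ((algebraMap L (AdeleRing (𝓞 L) L)).comp (algebraMap (Fp L) L)) with hT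
  set F := Matrix.fromBlocks (1 : Matrix (Fin n) (Fin n) (AdeleRing (𝓞 L) L)) 0 (-1) 1 * blk L e dV hdV dW hdW p * Matrix.fromBlocks 1 0 1 1 with hF
  have hun := frame_blk_unitary L e dV hdV dW hdW p
  rw [← hF] at hun
  have hp' : F.toBlocks₂₁ = 0 := (isSiegelDelta_iff_conj L e dV hdV dW hdW p).1 hp
  rw [eq_fromBlocks_of_toBlocks₂₁_eq_zero hp'] at hun
  have h12 := congrArg Matrix.toBlocks₁₂ hun
  rw [Matrix.fromBlocks_map, Matrix.fromBlocks_transpose, Matrix.fromBlocks_multiply, Matrix.fromBlocks_multiply, Matrix.toBlocks_fromBlocks₁₂,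
    Matrix.toBlocks_fromBlocks₁₂] at h12
  simp only [Matrix.map_zero _ (map_zero _), Matrix.transpose_zero, Matrix.zero_mul, Matrix.mul_zero, neg_zero, add_zero, zero_add,
    Matrix.mul_neg, Matrix.neg_mul, neg_inj] at h12
  rw [deltaBlock_eq_conj, ← hF]
  simpa only [Matrix.mul_assoc] using h12

/-! ## §3 Rational Siegel elements: `ψ_S(p⁻¹ u p) = ψ_{D₀ S A₀⁻¹}(u)` -/

/-- **Rational Levi blocks**: for `p ∈ P_Δ ∩ H(L⁺)` there are `A₀, D₀ ∈ M_n(L)`, `det A₀ ≠ 0`, with `deltaBlock p = A₀ ⊗ 1`, `d(p) = D₀ ⊗ 1` and the rational Levi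
relation `c(A₀)ᵀ T_L D₀ = T_L`. [cite: HarrisKudlaSweet1996, §1 (1.11)] -/
theorem exists_rat_levi_blocks (hdV0 : ∀ i, dV i ≠ 0) (hdW0 : ∀ i, dW i ≠ 0) {p : HA L e dV hdV dW hdW} (hp : IsSiegelDelta L e dV hdV dW hdW p)
    (hpr : p ∈ ratH L e dV hdV dW hdW) :
    ∃ A₀ D₀ : Matrix (Fin n) (Fin n) L, IsUnit A₀.det ∧
      deltaBlock L e dV hdV dW hdW p = A₀.map (algebraMap L (AdeleRing (𝓞 L) L)) ∧
      (Matrix.fromBlocks (1 : Matrix (Fin n) (Fin n) (AdeleRing (𝓞 L) L)) 0 (-1) 1 * blk L e dV hdV dW hdW p * Matrix.fromBlocks 1 0 1 1).toBlocks₂₂ =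
        D₀.map (algebraMap L (AdeleRing (𝓞 L) L)) ∧
      (A₀.map ((IsCMField.complexConj L : L ≃ₐ[Fp L] L) : L →+* L))ᵀ * (gramR L e dV hdV dW hdW).map (algebraMap (Fp L) L) * D₀ =
        (gramR L e dV hdV dW hdW).map (algebraMap (Fp L) L) := by
  obtain ⟨g, hg⟩ := (mem_range_toAdelic_iff (Fp L) L (IsCMField.complexConj L) (hermD L e dV hdV dW hdW) p).1 hpr
  set f := algebraMap L (AdeleRing (𝓞 L) L) with hf
  set B₀ : Matrix (Fin n ⊕ Fin n) (Fin n ⊕ Fin n) L := Matrix.reindex (e₂ (n := n)).symm (e₂ (n := n)).symm (g : Matrix (Fin (n + n)) (Fin (n + n)) L) with hB₀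
  have hblk : blk L e dV hdV dW hdW p = B₀.map f := by
    have h1 : ((p : GL (Fin (n + n)) (AdeleRing (𝓞 L) L)) : Matrix (Fin (n + n)) (Fin (n + n)) (AdeleRing (𝓞 L) L)) =
        (g : Matrix (Fin (n + n)) (Fin (n + n)) L).map f := by rw [← hg]; rfl
    ext i j
    simp only [blk, Matrix.reindex_apply, Matrix.submatrix_apply, h1, Matrix.map_apply, hB₀]
  set F₀ : Matrix (Fin n ⊕ Fin n) (Fin n ⊕ Fin n) L := Matrix.fromBlocks (1 : Matrix (Fin n) (Fin n) L) 0 (-1) 1 * B₀ * Matrix.fromBlocks 1 0 1 1 with hF₀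
  have hframe : Matrix.fromBlocks (1 : Matrix (Fin n) (Fin n) (AdeleRing (𝓞 L) L)) 0 (-1) 1 * blk L e dV hdV dW hdW p * Matrix.fromBlocks 1 0 1 1 = F₀.map f := by
    rw [hblk, hF₀, Matrix.map_mul, Matrix.map_mul]
    simp only [Matrix.fromBlocks_map, Matrix.map_one f (map_zero f) (map_one f), Matrix.map_zero f (map_zero f), Matrix.map_neg f (map_neg f)]
  have ha : deltaBlock L e dV hdV dW hdW p = (F₀.toBlocks₁₁).map f := by
    rw [deltaBlock_eq_conj, hframe]; rfl
  have hd : (Matrix.fromBlocks (1 : Matrix (Fin n) (Fin n) (AdeleRing (𝓞 L) L)) 0 (-1) 1 * blk L e dV hdV dW hdW p * Matrix.fromBlocks 1 0 1 1).toBlocks₂₂ =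
      (F₀.toBlocks₂₂).map f := by
    rw [hframe]; rfl
  obtain ⟨hTLu, hTLc, hTLt, hTLmap⟩ := gramRL_facts L e dV hdV dW hdW hdV0 hdW0
  refine ⟨F₀.toBlocks₁₁, F₀.toBlocks₂₂, ?_, ha, hd, ?_⟩
  · -- `det A₀ ≠ 0`: its image `det a` is a unit
    have hu := isUnit_detDelta_of_isSiegelDelta L e dV hdV dW hdW p hp
    unfold detDelta at hu
    rw [ha, ← RingHom.mapMatrix_apply, ← RingHom.map_det] at hu
    rw [isUnit_iff_ne_zero]
    intro h0
    rw [h0, map_zero, isUnit_zero_iff] at hu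
    exact zero_ne_one ((AdeleRing.algebraMap_injective (𝓞 L) L) (by rw [map_zero, map_one]; exact hu))
  · -- the Levi relation descends along the injective `L → 𝔸_L`
    have hrel := levi_rel L e dV hdV dW hdW hp
    rw [ha, hd, ← hTLmap, ← map_cstar f (algebraMap_complexConj L), ← Matrix.map_mul, ← Matrix.map_mul] at hrel
    have hinj : Function.Injective (fun A : Matrix (Fin n) (Fin n) L => A.map f) := fun A B h => by
      ext i j; exact AdeleRing.algebraMap_injective (𝓞 L) L (by simpa using congrFun (congrFun h i) j)
    exact hinj hrel

/-- **LEVI BOOKKEEPING: `ψ_S(p⁻¹ u p) = ψ_{D₀ S A₀⁻¹}(u)`** for a rational Siegel `p` with rational Levi blocks `(A₀, D₀)` as in `exists_rat_levi_blocks` and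
`u ∈ N_Δ(𝔸)` (`X(p⁻¹ u p) = a⁻¹ X(u) d`, `tr(S a⁻¹ X d) = tr((d S a⁻¹) X)`). [cite: MoeglinWaldspurger1995, II.1.7] [cite: HarrisKudlaSweet1996, §1 (1.12)] -/
theorem unipDeltaChar_conj_eq {p : HA L e dV hdV dW hdW} (hp : IsSiegelDelta L e dV hdV dW hdW p) {A₀ D₀ : Matrix (Fin n) (Fin n) L} (hA₀ : IsUnit A₀.det)
    (ha : deltaBlock L e dV hdV dW hdW p = A₀.map (algebraMap L (AdeleRing (𝓞 L) L)))
    (hd : (Matrix.fromBlocks (1 : Matrix (Fin n) (Fin n) (AdeleRing (𝓞 L) L)) 0 (-1) 1 * blk L e dV hdV dW hdW p * Matrix.fromBlocks 1 0 1 1).toBlocks₂₂ =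
      D₀.map (algebraMap L (AdeleRing (𝓞 L) L)))
    (S : Matrix (Fin n) (Fin n) L) {u : HA L e dV hdV dW hdW} (hu : u ∈ unipDelta L e dV hdV dW hdW) :
    unipDeltaChar L e dV hdV dW hdW S (p⁻¹ * u * p) = unipDeltaChar L e dV hdV dW hdW (D₀ * S * A₀⁻¹) u := by
  set f := algebraMap L (AdeleRing (𝓞 L) L) with hf
  have hcorner := deltaBlock_mul_toBlocks₁₂_conj L e dV hdV dW hdW hp hu
  rw [ha, hd] at hcorner
  have hAu : IsUnit (A₀.map f).det := by rw [← RingHom.mapMatrix_apply, ← RingHom.map_det]; exact hA₀.map _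
  have hX' : (blk L e dV hdV dW hdW (p⁻¹ * u * p)).toBlocks₁₂ = (A₀.map f)⁻¹ * ((blk L e dV hdV dW hdW u).toBlocks₁₂ * D₀.map f) := by
    rw [← hcorner, Matrix.nonsing_inv_mul_cancel_left _ _ hAu]
  rw [unipDeltaChar_apply, unipDeltaChar_apply, hX', Matrix.map_mul, Matrix.map_mul, map_nonsing_inv_of_isUnit f hA₀,
    show S.map f * ((A₀.map f)⁻¹ * ((blk L e dV hdV dW hdW u).toBlocks₁₂ * D₀.map f)) =
      (S.map f * (A₀.map f)⁻¹) * ((blk L e dV hdV dW hdW u).toBlocks₁₂ * D₀.map f) by simp only [Matrix.mul_assoc],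
    Matrix.trace_mul_comm, show (blk L e dV hdV dW hdW u).toBlocks₁₂ * D₀.map f * (S.map f * (A₀.map f)⁻¹) =
      (blk L e dV hdV dW hdW u).toBlocks₁₂ * (D₀.map f * S.map f * (A₀.map f)⁻¹) by simp only [Matrix.mul_assoc], Matrix.trace_mul_comm]

/-- **the conjugated index is again `T_L`-skew** (`skew_conj_of_rel` with the rational Levi relation). [cite: HarrisKudlaSweet1996, §1 (1.11)] -/
theorem conj_index_mem_skewMatrices (hdV0 : ∀ i, dV i ≠ 0) (hdW0 : ∀ i, dW i ≠ 0) {A₀ D₀ : Matrix (Fin n) (Fin n) L} (hA₀ : IsUnit A₀.det)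
    (hrel : (A₀.map ((IsCMField.complexConj L : L ≃ₐ[Fp L] L) : L →+* L))ᵀ * (gramR L e dV hdV dW hdW).map (algebraMap (Fp L) L) * D₀ =
      (gramR L e dV hdV dW hdW).map (algebraMap (Fp L) L))
    {S : Matrix (Fin n) (Fin n) L} (hS : S ∈ skewMatrices ((IsCMField.complexConj L : L ≃ₐ[Fp L] L) : L →+* L) ((gramR L e dV hdV dW hdW).map (algebraMap (Fp L) L))) :
    D₀ * S * A₀⁻¹ ∈ skewMatrices ((IsCMField.complexConj L : L ≃ₐ[Fp L] L) : L →+* L) ((gramR L e dV hdV dW hdW).map (algebraMap (Fp L) L)) := by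
  obtain ⟨-, hTLc, hTLt, -⟩ := gramRL_facts L e dV hdV dW hdW hdV0 hdW0
  exact skew_conj_of_rel _ hTLc hTLt (fun x => IsCMField.complexConj_apply_apply L x) hA₀ hrel hS

/-- `det (D₀ S A₀⁻¹) ≠ 0 ⟺ det S ≠ 0` for invertible `A₀, D₀` (the Levi relation makes `D₀` invertible). [folklore] -/
theorem det_conj_index_ne_zero_iff (hdV0 : ∀ i, dV i ≠ 0) (hdW0 : ∀ i, dW i ≠ 0) {A₀ D₀ : Matrix (Fin n) (Fin n) L} (hA₀ : IsUnit A₀.det)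
    (hrel : (A₀.map ((IsCMField.complexConj L : L ≃ₐ[Fp L] L) : L →+* L))ᵀ * (gramR L e dV hdV dW hdW).map (algebraMap (Fp L) L) * D₀ =
      (gramR L e dV hdV dW hdW).map (algebraMap (Fp L) L)) (S : Matrix (Fin n) (Fin n) L) :
    (D₀ * S * A₀⁻¹).det ≠ 0 ↔ S.det ≠ 0 := by
  obtain ⟨hTLu, -, -, -⟩ := gramRL_facts L e dV hdV dW hdW hdV0 hdW0
  have hD₀ : IsUnit D₀.det := by
    have h := congrArg Matrix.det hrel
    rw [Matrix.det_mul, Matrix.det_mul] at h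
    exact isUnit_of_mul_isUnit_right (by rw [h]; exact hTLu)
  rw [Matrix.det_mul, Matrix.det_mul, Matrix.det_nonsing_inv]
  rw [isUnit_iff_ne_zero] at hA₀ hD₀
  constructor
  · intro h hS; apply h; rw [hS, mul_zero, zero_mul]
  · intro hS h
    rcases mul_eq_zero.1 h with h1 | h1
    · rcases mul_eq_zero.1 h1 with h2 | h2
      · exact hD₀ h2
      · exact hS h2
    · exact hA₀ (by rwa [Ring.inverse_eq_inv, inv_eq_zero] at h1)

end Summit.HodgeConjecture.HodgeConjecture.Cruxes.HLiu418.K2LiuSiegelLeviConjUnipDeltaChar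

end
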